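import Mathlib
import HarnessLib
import Summits.HubbardSuperconductivity.HubbardSuperconductivity.Theorems.KLProgrammeKLRegimeEngineTowerLevZSuccOfBlockBounds
import Summits.HubbardSuperconductivity.HubbardSuperconductivity.Theorems.KLProgrammeKLRegimeEngineTowerBlockZeroLinkDataFKlEng

/-!
# Route `KLProgramme` — crux K3 ENGINE (stmt-HubbardSuperconductivity-20437 `KLRegimeEngineV17F2`), stub (b) v2, THE LEVELS PACKAGE (ℓ): «(ℓ)-BLOCK0-Z» —
# the partition function of the frame propagates along a PARTIAL slice `(Λ_j, Λ_{dk}]` under the kit guard, and along block `0` on `K_n` from `Z^{K_n}_{Λ_1}`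
# (cell gate-hubbard-kl, seat gate-hubbard-kl-p3 g22; partial twins of k3c3-p2 g16's `hubbardEffPartitionFnCT_klScale_block_succ_ne_zero_of_guard/_of_kitGuard`
# (…TowerLevZUnitOfKitGuard) and of k3c2-p3 g14's `towerZ_succ_of_bounds` (…TowerLevZSuccOfBlockBounds §1), proofs verbatim with `J₂ := j` ∘ p3 g21's
# `linkDataBlockZeroF_klEng` (…TowerBlockZeroLinkDataFKlEng))

WHY.  The «(ℓ)-REKEY-ROWS» chain (p3 g22: `klTowerBLevF_le_law_lev_of_blocks_ZX_rows` → … → `kernelNormsLevels_all_klEng_final_rows`) takes the tower's base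
partition function `Z^{K_n}_{Λ_d} ≠ 0` as a binder (the chain of record derived it from the `(Λ_d, F_{d−1})` weighted grid step, now gone).  The Z-step lemmas are
slice-generic underneath (`isUnit_effPartitionFn_blockStep_lev` takes any `J₁ ≤ J₂`), so the partial twins §1–§2 give `Z^K_{Λ_{dk}} ≠ 0 ⇒ Z^K_{Λ_j} ≠ 0` for every
`j ≥ dk` under the partial slice's data and the SAME kit guard (the guard reads only the input profile `klTowerMuLevF … d k`); at `(d, k) := (1, 1)` with the
block-`0` bundle this is §3: `Z^{K_n}_{Λ_1} ≠ 0` (p3 g21's `exists_partitionFn_scaleOne_ne_zero`) and the block-`0` kit guard — which the block-`0` read-out's born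
step (`blockZeroIncrLevF_le_kitStep_klEng`) needs anyway — give `Z^{K_n}_{Λ_j} ≠ 0` for `1 ≤ j ≤ d`, in particular the binder `Z^{K_n}_{Λ_d} ≠ 0`.

* §1 `hubbardEffPartitionFnCT_klScale_partial_ne_zero_of_guard`, `…_of_kitGuard`; §2 `towerZ_partial_of_bounds`; §3 **`towerZ_blockZero_klEng (d R c″)`**.
Compositions of landed theorems; nothing about the model is asserted beyond them; nothing asserts (ℓ), any stub, K3 or superconductivity.
References: BGM 2006 §2.3 (2.13)–(2.14), §2.8 (2.76)–(2.84), §3 (3.2)–(3.8) [cite: BenfattoGiulianiMastropietro2006]; Salmhofer 1999 §2.5.1 (2.105)–(2.106) [cite: Salmhofer1999].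
-/

noncomputable section

namespace Summit.HubbardSuperconductivity.HubbardSuperconductivity.Theorems.EngineV8

set_option linter.dupNamespace false -- summit = problem name (single-conjunct summit), D-0017

open Classical
open Real Finset Literature.MathematicalPhysics.QuantumLattice Literature.Probability.LatticeModels GrassmannAlgebra
open Literature.MathematicalPhysics.QuantumLattice.FermiRG Literature.MathematicalPhysics.QuantumLattice.FermiRG.BGM2006Routing
open Summit.HubbardSuperconductivity.HubbardSuperconductivity.Theorems.KLProgrammeLegKernels
open Summit.HubbardSuperconductivity.HubbardSuperconductivity.Theorems.KLRegimeSplit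
open Summit.HubbardSuperconductivity.HubbardSuperconductivity.Theorems.KLRegimeWick
open Summit.HubbardSuperconductivity.HubbardSuperconductivity.Theorems.TwoPointAssembly
open Summit.HubbardSuperconductivity.HubbardSuperconductivity.Theorems.DispersionFlow
open Summit.HubbardSuperconductivity.HubbardSuperconductivity.Theorems.TorusFourierL2

variable {L M : ℕ} [NeZero L] [NeZero M]

/-! ## §1 The Z-step along a partial slice under the guard -/

/-- **`Z^K_{Λ_{dk}} ≠ 0` ⇒ `Z^K_{Λ_j} ≠ 0` FOR EVERY `j ≥ dk`, UNDER THE PARTIAL-SLICE DATA AND THE GUARD `e·α/κ²·towerV D τ Nt < 1`** (partial twin of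
`hubbardEffPartitionFnCT_klScale_block_succ_ne_zero_of_guard`: slice `(Λ_j, Λ_{dk}]`, `1 ≤ d`, `1 ≤ k`; `isUnit_effPartitionFn_blockStep_lev` takes any `J₁ ≤ J₂`).  The majorant `Nt` is any track-blind array with `Nt 0 = 0` dominating the level-`0` measured sizes `ε·klTowerMeasLev … d k (2m) 0`; `D ≥ card/2`,
`(e²(κ+ρ))² ≤ τ`. [cite: BenfattoGiulianiMastropietro2006, §2.3 (2.13)-(2.14), §2.8 (2.76)-(2.84), §3 (3.2)-(3.8)] -/
theorem hubbardEffPartitionFnCT_klScale_partial_ne_zero_of_guard {β : ℝ} (hβ : 0 < β) (U μ : ℝ) (K : TrigPolyC4v) {d k : ℕ}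
    (hd : 1 ≤ d) (hk : 1 ≤ k) {j : ℕ} (hj : d * k ≤ j) (hZ : hubbardEffPartitionFnCT L M β U μ 0 K (klScale klE0 (d * k)) ≠ 0)
    {κ : ℝ} (hκ : 0 < κ)
    (hGB : IsGramBoundedR ((sectorSubMatrix L M β (bgmFatMultiplier L M klE0 β (nambuXiCT L μ K) (d * k - 1))).transpose *
      hubbardCovSliceCT L M β μ 0 K (klScale klE0 j) (klScale klE0 (d * k)) *
        sectorSubMatrix L M β (bgmFatMultiplier L M klE0 β (nambuXiCT L μ K) (d * k - 1))) κ)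
    {α : ℝ} (hα : 0 < α)
    (hrow : ∀ X, ∑ Y, ‖((sectorSubMatrix L M β (bgmFatMultiplier L M klE0 β (nambuXiCT L μ K) (d * k - 1))).transpose *
        hubbardCovSliceCT L M β μ 0 K (klScale klE0 j) (klScale klE0 (d * k)) *
          sectorSubMatrix L M β (bgmFatMultiplier L M klE0 β (nambuXiCT L μ K) (d * k - 1))) X Y‖ ≤ α)
    (hcol : ∀ Y, ∑ X, ‖((sectorSubMatrix L M β (bgmFatMultiplier L M klE0 β (nambuXiCT L μ K) (d * k - 1))).transpose *
        hubbardCovSliceCT L M β μ 0 K (klScale klE0 j) (klScale klE0 (d * k)) *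
          sectorSubMatrix L M β (bgmFatMultiplier L M klE0 β (nambuXiCT L μ K) (d * k - 1))) X Y‖ ≤ α)
    {ρ : ℝ} (hρ : 0 < ρ)
    {Nt : ℕ → ℝ} (hNt0 : ∀ m, 0 ≤ Nt m) (hNt00 : Nt 0 = 0)
    (hNtB : ∀ m, imagTimeWeight β M * klTowerMeasLev L M β U μ K d k (2 * m) 0 ≤ Nt m)
    {D : ℕ} (hD : Fintype.card (SpaceTimeIdx L M × SectorLeg (sectorCount (d * k - 1))) / 2 ≤ D)
    {τ : ℝ} (hτ2 : (exp 2 * (κ + ρ)) ^ 2 ≤ τ)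
    (hguard : exp 1 * α / κ ^ 2 * towerV D τ Nt < 1) :
    hubbardEffPartitionFnCT L M β U μ 0 K (klScale klE0 j) ≠ 0 := by
  have hε : 0 ≤ imagTimeWeight β M := imagTimeWeight_nonneg hβ.le M
  have hτ0 : 0 ≤ τ := le_trans (by positivity) hτ2
  have hJ₁ : 1 ≤ d * k := hk.trans (Nat.le_mul_of_pos_left k hd)
  -- the door's `θ < 1` from the guard (as in …TowerBlockIncrLevOrientedKitF)
  have hB0 : ∀ m c, 0 ≤ (fun m c : ℕ => klTowerMeasLev L M β U μ K d k (2 * m) c) m c := fun m c =>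
    klTowerMeasLev_nonneg hβ.le U μ K d k _ _
  have h1 : ∀ m', (27 : ℝ) ^ 0 * (imagTimeWeight β M * klTowerMeasLev L M β U μ K d k (2 * m') 0) ≤ Nt m' := fun m' => by
    rw [pow_zero, one_mul]; exact hNtB m'
  have hnV : normV (SpaceTimeIdx L M × SectorLeg (sectorCount (d * k - 1))) κ ρ
      (fun m' => (27 : ℝ) ^ 0 * (imagTimeWeight β M * klTowerMeasLev L M β U μ K d k (2 * m') 0)) ≤ towerV D τ Nt :=
    (normV_mono hκ.le hρ.le h1).trans
      ((normV_le_towerV hκ.le hρ.le hNt0 hNt00 hD).trans (towerV_mono (by positivity) hτ2 hNt0 fun _ => le_rfl))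
  have hθ : Real.exp 1 * α * normV (SpaceTimeIdx L M × SectorLeg (sectorCount (d * k - 1))) κ ρ
      (fun m' => (27 : ℝ) ^ 0 * (imagTimeWeight β M * klTowerMeasLev L M β U μ K d k (2 * m') 0)) / κ ^ 2 < 1 := by
    calc Real.exp 1 * α * normV (SpaceTimeIdx L M × SectorLeg (sectorCount (d * k - 1))) κ ρ
          (fun m' => (27 : ℝ) ^ 0 * (imagTimeWeight β M * klTowerMeasLev L M β U μ K d k (2 * m') 0)) / κ ^ 2
        = exp 1 * α / κ ^ 2 * normV (SpaceTimeIdx L M × SectorLeg (sectorCount (d * k - 1))) κ ρ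
            (fun m' => (27 : ℝ) ^ 0 * (imagTimeWeight β M * klTowerMeasLev L M β U μ K d k (2 * m') 0)) := by ring
      _ ≤ exp 1 * α / κ ^ 2 * towerV D τ Nt := mul_le_mul_of_nonneg_left hnV (by positivity)
      _ < 1 := hguard
  -- the step partition function is a unit (p5 g13), hence the partition function at the next boundary
  have hunit := isUnit_effPartitionFn_blockStep_lev (L := L) (M := M) hβ μ K (J₁ := d * k) (J₂ := j) hJ₁ hj
    (klTowerInput L M β U μ K d k) (klEffectiveAction_mem_evenPart hβ.ne' U μ K klE0 (d * k))
    (constPart_klEffectiveAction_eq_zero β U μ K klE0 (d * k) hZ) hκ hGB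
    (fun m c : ℕ => klTowerMeasLev L M β U μ K d k (2 * m) c) hB0
    (fun m' Fc E τ' q hq hE y => doorInput_klTowerInput_le_klTowerMeasLev hβ.le U μ K d k m' Fc E τ' q hq hE y) hα hrow hcol hρ hθ
  exact hubbardEffPartitionFnCT_klScale_ne_zero_of_step β U μ K j hZ hunit

/-- **The same under KitF's literal kit guard `e·9α/κ²·towerV D τ Nt < 1`**: `Z^K_{Λ_{dk}} ≠ 0 ⇒ Z^K_{Λ_j} ≠ 0` for `dk ≤ j` (partial twin of
`hubbardEffPartitionFnCT_klScale_block_succ_ne_zero_of_kitGuard`). [cite: BenfattoGiulianiMastropietro2006, §2.3 (2.13)-(2.14), §3 (3.2)-(3.8)] -/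
theorem hubbardEffPartitionFnCT_klScale_partial_ne_zero_of_kitGuard {β : ℝ} (hβ : 0 < β) (U μ : ℝ) (K : TrigPolyC4v) {d k : ℕ}
    (hd : 1 ≤ d) (hk : 1 ≤ k) {j : ℕ} (hj : d * k ≤ j) (hZ : hubbardEffPartitionFnCT L M β U μ 0 K (klScale klE0 (d * k)) ≠ 0)
    {κ : ℝ} (hκ : 0 < κ)
    (hGB : IsGramBoundedR ((sectorSubMatrix L M β (bgmFatMultiplier L M klE0 β (nambuXiCT L μ K) (d * k - 1))).transpose *
      hubbardCovSliceCT L M β μ 0 K (klScale klE0 j) (klScale klE0 (d * k)) *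
        sectorSubMatrix L M β (bgmFatMultiplier L M klE0 β (nambuXiCT L μ K) (d * k - 1))) κ)
    {α : ℝ} (hα : 0 < α)
    (hrow : ∀ X, ∑ Y, ‖((sectorSubMatrix L M β (bgmFatMultiplier L M klE0 β (nambuXiCT L μ K) (d * k - 1))).transpose *
        hubbardCovSliceCT L M β μ 0 K (klScale klE0 j) (klScale klE0 (d * k)) *
          sectorSubMatrix L M β (bgmFatMultiplier L M klE0 β (nambuXiCT L μ K) (d * k - 1))) X Y‖ ≤ α)
    (hcol : ∀ Y, ∑ X, ‖((sectorSubMatrix L M β (bgmFatMultiplier L M klE0 β (nambuXiCT L μ K) (d * k - 1))).transpose *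
        hubbardCovSliceCT L M β μ 0 K (klScale klE0 j) (klScale klE0 (d * k)) *
          sectorSubMatrix L M β (bgmFatMultiplier L M klE0 β (nambuXiCT L μ K) (d * k - 1))) X Y‖ ≤ α)
    {ρ : ℝ} (hρ : 0 < ρ)
    {Nt : ℕ → ℝ} (hNt0 : ∀ m, 0 ≤ Nt m) (hNt00 : Nt 0 = 0)
    (hNtB : ∀ m, imagTimeWeight β M * klTowerMeasLev L M β U μ K d k (2 * m) 0 ≤ Nt m)
    {D : ℕ} (hD : Fintype.card (SpaceTimeIdx L M × SectorLeg (sectorCount (d * k - 1))) / 2 ≤ D)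
    {τ : ℝ} (hτ2 : (exp 2 * (κ + ρ)) ^ 2 ≤ τ)
    (hguard : exp 1 * (9 * α) / κ ^ 2 * towerV D τ Nt < 1) :
    hubbardEffPartitionFnCT L M β U μ 0 K (klScale klE0 j) ≠ 0 := by
  have hτ0 : 0 ≤ τ := le_trans (by positivity) hτ2
  have hV0 : 0 ≤ towerV D τ Nt := towerV_nonneg (D := D) hτ0 hNt0
  refine hubbardEffPartitionFnCT_klScale_partial_ne_zero_of_guard hβ U μ K hd hk hj hZ hκ hGB hα hrow hcol hρ hNt0 hNt00 hNtB hD hτ2 ?_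
  calc exp 1 * α / κ ^ 2 * towerV D τ Nt ≤ exp 1 * (9 * α) / κ ^ 2 * towerV D τ Nt := by
        refine mul_le_mul_of_nonneg_right ?_ hV0
        exact div_le_div_of_nonneg_right (mul_le_mul_of_nonneg_left (by linarith) (exp_pos 1).le) (sq_nonneg κ)
    _ < 1 := hguard


/-! ## §2 The partial Z-step at the k-free bounds -/

set_option maxHeartbeats 400000 in
/-- **THE Z-STEP AT THE k-FREE BOUNDS, PARTIAL SLICE `(Λ_j, Λ_{dk}]`, `dk ≤ j`** (partial twin of `towerZ_succ_of_bounds`).  For `1 ≤ d`, `1 ≤ k`,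
`Z^K_{Λ_{dk}} ≠ 0`, the slice's Gram constant `κ` with `κ²·8^{dk} ≤ κ̄²`, rows/cols `≤ α ≤ ᾱ·4^{dk}`,
constants `c̄r, c̄c > 0`, `card/2 ≤ D`: the LAW guard `Φ̄·towerV D τ̄ (W̄·Z̄^m·klTowerMuLevF … d k m) < 1` of «(ℓ)-LINK-UNIFORM-F» implies `Z^K_{Λ_j} ≠ 0`.
[cite: BenfattoGiulianiMastropietro2006, §2.8 (2.76)-(2.84), §3 (3.2)-(3.8)] -/
theorem towerZ_partial_of_bounds {β : ℝ} (hβ : 0 < β) (U μ : ℝ) (K : TrigPolyC4v) {d k j : ℕ} (hd : 1 ≤ d) (hk : 1 ≤ k) (hj : d * k ≤ j)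
    (hZ : hubbardEffPartitionFnCT L M β U μ 0 K (klScale klE0 (d * k)) ≠ 0)
    {κ κb : ℝ} (hκ : 0 < κ) (hκb : 0 < κb) (hκκb : κ ^ 2 * (8 : ℝ) ^ (d * k) ≤ κb ^ 2)
    (hGB : IsGramBoundedR ((sectorSubMatrix L M β (bgmFatMultiplier L M klE0 β (nambuXiCT L μ K) (d * k - 1))).transpose *
      hubbardCovSliceCT L M β μ 0 K (klScale klE0 j) (klScale klE0 (d * k)) *
        sectorSubMatrix L M β (bgmFatMultiplier L M klE0 β (nambuXiCT L μ K) (d * k - 1))) κ)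
    {α αb : ℝ} (hαb : 0 < αb) (hααb : α ≤ αb * (4 : ℝ) ^ (d * k))
    (hrow : ∀ X, ∑ Y, ‖((sectorSubMatrix L M β (bgmFatMultiplier L M klE0 β (nambuXiCT L μ K) (d * k - 1))).transpose *
        hubbardCovSliceCT L M β μ 0 K (klScale klE0 j) (klScale klE0 (d * k)) *
          sectorSubMatrix L M β (bgmFatMultiplier L M klE0 β (nambuXiCT L μ K) (d * k - 1))) X Y‖ ≤ α)
    (hcol : ∀ Y, ∑ X, ‖((sectorSubMatrix L M β (bgmFatMultiplier L M klE0 β (nambuXiCT L μ K) (d * k - 1))).transpose *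
        hubbardCovSliceCT L M β μ 0 K (klScale klE0 j) (klScale klE0 (d * k)) *
          sectorSubMatrix L M β (bgmFatMultiplier L M klE0 β (nambuXiCT L μ K) (d * k - 1))) X Y‖ ≤ α)
    {crb ccb : ℝ} (hcrb : 0 < crb) (hccb : 0 < ccb)
    {D : ℕ} (hD : Fintype.card (SpaceTimeIdx L M × SectorLeg (sectorCount (d * k - 1))) / 2 ≤ D)
    (hguard : 9 * αb * ccb / ((27 : ℝ) ^ 5 * exp 1 * κb ^ 2 * crb) *
      towerV D (exp 2 * κb ^ 2 / ccb ^ 2)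
        (fun m => 64 * (27 : ℝ) ^ 4 * exp 2 * crb / ccb * (exp 4 * ccb ^ 2 * imagTimeWeight β M ^ 2 / 8) ^ m * klTowerMuLevF L M β U μ K d k m) < 1) :
    hubbardEffPartitionFnCT L M β U μ 0 K (klScale klE0 j) ≠ 0 := by
  have hx : 0 < imagTimeWeight β M := imagTimeWeight_pos_of_pos (M := M) hβ
  have hJ₁ : 1 ≤ d * k := le_trans hd (Nat.le_mul_of_pos_right d hk)
  have h8 : (0 : ℝ) < (8 : ℝ) ^ (d * k) := by positivity
  have he4 : 0 < exp 4 := exp_pos 4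
  have he4' : exp 4 = exp 2 ^ 2 := by rw [← Real.exp_nat_mul]; norm_num
  have he6' : exp 6 = exp 2 * exp 4 := by rw [← exp_add]; norm_num
  have he2' : exp 2 = exp 1 ^ 2 := by rw [← Real.exp_nat_mul]; norm_num
  -- the Gram constant at the bound: `κ′ ≥ κ`, `κ′²·8^{dk} = κ̄²`
  obtain ⟨κ', hκ'0, hκκ', hκ'sq⟩ := exists_sqrt_scaled hκ hκb h8 hκκb
  have hGB' := TorusFourierL2.isGramBoundedR_of_le hGB hκ.le hκκ'
  -- the decay constant at the bound
  have hα'0 : 0 < αb * (4 : ℝ) ^ (d * k) := by positivity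
  have hrow2 : ∀ X, ∑ Y, ‖((sectorSubMatrix L M β (bgmFatMultiplier L M klE0 β (nambuXiCT L μ K) (d * k - 1))).transpose *
      hubbardCovSliceCT L M β μ 0 K (klScale klE0 j) (klScale klE0 (d * k)) *
        sectorSubMatrix L M β (bgmFatMultiplier L M klE0 β (nambuXiCT L μ K) (d * k - 1))) X Y‖ ≤ αb * (4 : ℝ) ^ (d * k) :=
    fun X => (hrow X).trans hααb
  have hcol2 : ∀ Y, ∑ X, ‖((sectorSubMatrix L M β (bgmFatMultiplier L M klE0 β (nambuXiCT L μ K) (d * k - 1))).transpose *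
      hubbardCovSliceCT L M β μ 0 K (klScale klE0 j) (klScale klE0 (d * k)) *
        sectorSubMatrix L M β (bgmFatMultiplier L M klE0 β (nambuXiCT L μ K) (d * k - 1))) X Y‖ ≤ αb * (4 : ℝ) ^ (d * k) :=
    fun Y => (hcol Y).trans hααb
  -- kit parameters `τ := e⁶κ′²`, `ψ := κ′⁻²`, `ρ := κ′`
  have hτ2 : (exp 2 * (κ' + κ')) ^ 2 ≤ exp 6 * κ' ^ 2 := by
    have hk2 : 0 ≤ κ' ^ 2 := sq_nonneg _
    calc (exp 2 * (κ' + κ')) ^ 2 = 4 * exp 4 * κ' ^ 2 := by rw [he4']; ring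
      _ ≤ exp 2 * exp 4 * κ' ^ 2 := mul_le_mul_of_nonneg_right (mul_le_mul_of_nonneg_right four_le_exp_two he4.le) hk2
      _ = exp 6 * κ' ^ 2 := by rw [he6']
  -- abbreviations: units, arrays, parameters
  set ε : ℝ := imagTimeWeight β M with hε
  set Kc : ℝ := ε * ((((2 : ℝ) ^ (5 * (d * k))))⁻¹ * (ε ^ 2)⁻¹) with hKc
  set u : ℝ := (8 : ℝ) ^ (d * k) * ε ^ 2 with hu
  set μd : ℕ → ℝ := fun m => 32 * ε / 27 * (1 / 8 : ℝ) ^ m * klTowerMuLevF L M β U μ K d k m with hμd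
  set Φ : ℝ := exp 1 * (9 * (αb * (4 : ℝ) ^ (d * k))) / κ' ^ 2 with hΦ
  set W : ℝ := 64 * (27 : ℝ) ^ 4 * exp 2 * crb / ccb with hW
  set Z : ℝ := exp 4 * ccb ^ 2 * ε ^ 2 / 8 with hZ'
  set τb : ℝ := exp 2 * κb ^ 2 / ccb ^ 2 with hτb
  set Φb : ℝ := 9 * αb * ccb / ((27 : ℝ) ^ 5 * exp 1 * κb ^ 2 * crb) with hΦb
  set C : ℝ := 4 * (27 : ℝ) ^ 5 * (exp 4 / 2 * crb) with hC
  set K₂ : ℝ := (ε * exp 2 * ccb)⁻¹ with hK₂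
  set u₂ : ℝ := ε ^ 2 * exp 4 * ccb ^ 2 with hu₂
  have hμd0 : ∀ m, 0 ≤ μd m := fun m => by
    have := klTowerMuLevF_nonneg (L := L) (M := M) hβ U μ K d k m
    simp only [hμd]; positivity
  have hΦ0 : 0 ≤ Φ := by positivity
  -- the graded floor array in product units (as a function)
  have hBmNc : (fun m : ℕ => imagTimeWeight β M * klTowerMuLevF L M β U μ K d k m * klLevUnitF β M 0 m (d * k - 1) / 27) =
      fun m : ℕ => Kc * (u ^ m * μd m) := towerBmF_eq_units hβ U μ K hJ₁
  have hNc0 : ∀ m, 0 ≤ (fun m : ℕ => Kc * (u ^ m * μd m)) m := fun m => by have := hμd0 m; positivity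
  have hNc00 : (fun m : ℕ => Kc * (u ^ m * μd m)) 0 = 0 := by
    simp only [hμd, klTowerMuLevF_degree_zero, mul_zero]
  have hNtB : ∀ m, imagTimeWeight β M * klTowerMeasLev L M β U μ K d k (2 * m) 0 ≤ (fun m : ℕ => Kc * (u ^ m * μd m)) m := fun m => by
    rw [← hBmNc]; exact imagTimeWeight_mul_klTowerMeasLev_zero_le_towerBmF hβ U μ K d k hZ m
  -- the final array in product units (as a function)
  have hμbar : (fun m : ℕ => W * Z ^ m * klTowerMuLevF L M β U μ K d k m) = fun m : ℕ => (C * K₂) * (u₂ ^ m * μd m) := by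
    funext m
    simp only [hW, hZ', hC, hK₂, hu₂, hμd]
    rw [he4']
    field_simp
    ring
  -- guard bookkeeping: `towerV` of the two arrays
  have hVNc : towerV D (exp 6 * κ' ^ 2) (fun m : ℕ => Kc * (u ^ m * μd m)) = Kc * towerV D (exp 6 * κ' ^ 2 * u) μd := towerV_units D _ Kc u μd
  have hVbar : towerV D τb (fun m : ℕ => W * Z ^ m * klTowerMuLevF L M β U μ K d k m) = (C * K₂) * towerV D (τb * u₂) μd := by
    rw [hμbar]; exact towerV_units D _ (C * K₂) u₂ μd
  -- the four parameter identities and the output constant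
  have hτeq : τb * u₂ = exp 6 * κ' ^ 2 * u := by
    simp only [hτb, hu₂, hu]; rw [← hκ'sq, he6']; field_simp
  have h32 : (2 : ℝ) ^ (5 * (d * k)) = (4 : ℝ) ^ (d * k) * (8 : ℝ) ^ (d * k) := by
    rw [← mul_pow, show (4 : ℝ) * 8 = 2 ^ 5 by norm_num, ← pow_mul]
  have hΦeq : Φb * (C * K₂) = 2 * Φ * Kc := by
    simp only [hΦb, hC, hK₂, hΦ, hKc]
    rw [h32, ← hκ'sq, he4', he2']
    field_simp
    ring
  -- the guards of the kit form and of the re-truncation, from the final guard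
  have hguard2 : 2 * Φ * towerV D (exp 6 * κ' ^ 2) (fun m : ℕ => Kc * (u ^ m * μd m)) < 1 := by
    have key : 2 * Φ * towerV D (exp 6 * κ' ^ 2) (fun m : ℕ => Kc * (u ^ m * μd m)) =
        Φb * towerV D τb (fun m : ℕ => W * Z ^ m * klTowerMuLevF L M β U μ K d k m) := by
      rw [hVNc, hVbar, hτeq]
      calc 2 * Φ * (Kc * towerV D (exp 6 * κ' ^ 2 * u) μd) = (2 * Φ * Kc) * towerV D (exp 6 * κ' ^ 2 * u) μd := by ring
        _ = (Φb * (C * K₂)) * towerV D (exp 6 * κ' ^ 2 * u) μd := by rw [hΦeq]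
        _ = Φb * ((C * K₂) * towerV D (exp 6 * κ' ^ 2 * u) μd) := by ring
    rw [key]; exact hguard
  have hguardkit : exp 1 * (9 * (αb * (4 : ℝ) ^ (d * k))) / κ' ^ 2 * towerV D (exp 6 * κ' ^ 2) (fun m : ℕ => Kc * (u ^ m * μd m)) < 1 := by
    have hV0 : 0 ≤ towerV D (exp 6 * κ' ^ 2) (fun m : ℕ => Kc * (u ^ m * μd m)) := towerV_nonneg (by positivity) hNc0
    have : Φ * towerV D (exp 6 * κ' ^ 2) (fun m : ℕ => Kc * (u ^ m * μd m)) ≤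
        2 * Φ * towerV D (exp 6 * κ' ^ 2) (fun m : ℕ => Kc * (u ^ m * μd m)) := by
      rw [mul_assoc]; exact le_mul_of_one_le_left (mul_nonneg hΦ0 hV0) one_le_two
    exact lt_of_le_of_lt this hguard2
  -- the Z-step at the kit guard (k3c3-p2 g16, #18's first consumer)
  exact hubbardEffPartitionFnCT_klScale_partial_ne_zero_of_kitGuard (L := L) (M := M) hβ U μ K hd hk hj hZ hκ'0 hGB' hα'0 hrow2 hcol2 hκ'0
    hNc0 hNc00 hNtB hD hτ2 hguardkit

/-! ## §3 Block `0` on the flow frame: `Z^{K_n}_{Λ_1} ≠ 0 ⇒ Z^{K_n}_{Λ_j} ≠ 0`, `1 ≤ j ≤ d`, under the block-`0` kit guard -/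

/-- **THE PARTITION FUNCTION ALONG BLOCK `0` ON THE FLOW FRAME** («(ℓ)-BLOCK0-Z»): under `linkDataBlockZeroF_klEng`'s door prefix, for every `1 ≤ j ≤ d`,
`j ≤ n`: `Z^{K_n}_{Λ_1} ≠ 0`, a degree cap at `SpaceTimeIdx × SectorLeg (sectorCount 0)`, the four constants pinned as in `blockZeroIncrLevF_le_kitStep_klEng`,
and the block-`0` kit guard at `W̄·Z̄^m·klTowerMuLevF … (K_n) 1 1 m` imply `Z^{K_n}_{Λ_j} ≠ 0` — `towerZ_partial_of_bounds` at `(d, k) := (1, 1)` ∘ p3 g21's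
`linkDataBlockZeroF_klEng`.  At `j := d` this is the `Z^{K_n}_{Λ_d} ≠ 0` binder of the «(ℓ)-REKEY-ROWS» chain (`…_of_blocks_ZX_rows`, …, `kernelNormsLevels_all_klEng_final_rows`);
`Z^{K_n}_{Λ_1} ≠ 0` is p3 g21's `exists_partitionFn_scaleOne_ne_zero`. [cite: BenfattoGiulianiMastropietro2006, §2.3 (2.13)-(2.14), §2.8 (2.76)-(2.84), §3 (3.2)-(3.8)] -/
theorem towerZ_blockZero_klEng (d : ℕ) (R : RenConsts) (c'' : ℝ) (hc'' : 0 < c'') :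
    ∃ Cκ Cb CJ : ℝ, 0 < Cκ ∧ 0 < Cb ∧ 0 < CJ ∧
      ∀ (G : GeoConsts) (P : SplitConsts) (Q : EngConsts) (c : ℝ), P.WF → R.WF2 → 0 < c → c ≤ klEngC₃6 P R →
      ∀ μ ∈ klWindowC, ∀ U : ℝ, 0 < U → U ≤ klEngU₀9 P R c → c'' * U ≤ 1 →
      ∀ β : ℝ, klBetaMin ≤ β → β ≤ Real.exp (c / U ^ 2) →
      ∀ (L M : ℕ) [NeZero L] [NeZero M], klEngL₃ β U ≤ L → klEngM₃ β U L ≤ M →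
      ∀ n : ℕ, 1 ≤ n → n ≤ nScales β + 1 → IsKLRegime U c (-(n : ℤ)) →
        HistP klPredsV17F2 L M G P Q R β U μ 0 n → FrameOK R U (nScales β) μ (klFlowFrameU L M β U μ n) →
        (∀ m, 1 ≤ m → m < n → FlowPieceOscAt L M c'' β U μ m) →
      ∀ j : ℕ, 1 ≤ j → j ≤ d → j ≤ n →
        hubbardEffPartitionFnCT L M β U μ 0 (klFlowFrameU L M β U μ n) (klScale klE0 1) ≠ 0 →
      ∀ D : ℕ, Fintype.card (SpaceTimeIdx L M × SectorLeg (sectorCount 0)) / 2 ≤ D →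
      ∀ κb αb crb ccb : ℝ, κb = Real.sqrt (2 * Cκ * klE0) → αb = Cb * ((M : ℝ) / β) * (4 : ℝ) ^ d / klE0 →
        crb = 81 * CJ * M / β → ccb = 162 * CJ * M / β →
      9 * αb * ccb / ((27 : ℝ) ^ 5 * exp 1 * κb ^ 2 * crb) *
        towerV D (exp 2 * κb ^ 2 / ccb ^ 2)
          (fun m => 64 * (27 : ℝ) ^ 4 * exp 2 * crb / ccb * (exp 4 * ccb ^ 2 * imagTimeWeight β M ^ 2 / 8) ^ m *
            klTowerMuLevF L M β U μ (klFlowFrameU L M β U μ n) 1 1 m) < 1 →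
      hubbardEffPartitionFnCT L M β U μ 0 (klFlowFrameU L M β U μ n) (klScale klE0 j) ≠ 0 := by
  obtain ⟨Cκ, Cb, CJ, hCκ, hCb, hCJ, h⟩ := linkDataBlockZeroF_klEng d R c'' hc''
  refine ⟨Cκ, Cb, CJ, hCκ, hCb, hCJ, ?_⟩
  intro G P Q c hP hR2 hc hc6 μ hμ U hU hU9 hcU β hβmin hβc L M _ _ hL3 hM3 n hn1 hnN hreg hhist hfr hosc j hj1 hjd hjn hZ D hD
    κb αb crb ccb hκb hαb hcrb hccb hguard
  have he : (0 : ℝ) < klE0 := by norm_num [klE0]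
  have hβ : 0 < β := KLRegimeSplit.pos_of_klBetaMin_le hβmin
  have hM0 : (0 : ℝ) < M := Nat.cast_pos.2 (Nat.pos_of_ne_zero (NeZero.ne M))
  obtain ⟨hκ0, hκκb, hGB, hrow, hcol, hαle, -, -⟩ :=
    h G P Q c hP hR2 hc hc6 μ hμ U hU hU9 hcU β hβmin hβc L M hL3 hM3 n hn1 hnN hreg hhist hfr hosc j hj1 hjd hjn
  have hκb0 : 0 < κb := by rw [hκb]; positivity
  have hαb0 : 0 < αb := by rw [hαb]; positivity
  have hcrb0 : 0 < crb := by rw [hcrb]; positivity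
  have hccb0 : 0 < ccb := by rw [hccb]; positivity
  subst hκb hαb hcrb hccb
  exact towerZ_partial_of_bounds (d := 1) (k := 1) hβ U μ _ le_rfl le_rfl (by simpa using hj1) hZ hκ0 hκb0 hκκb hGB hαb0 hαle hrow hcol
    hcrb0 hccb0 hD hguard

end Summit.HubbardSuperconductivity.HubbardSuperconductivity.Theorems.EngineV8

end
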